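import Summits.CriticalPhenomena.PercolationContinuityZ3.Theorems.Transplant.TriFilmRouteX3
import Summits.CriticalPhenomena.PercolationContinuityZ3.Theorems.Transplant.HexShadowLinkageNode
import HarnessLib

/-!
# LOCAL LINKAGE FOR THE TRIANGULAR FILMS `𝕋 × {0..k}` (`k ≥ 2`) — hence `θ_v(p_c) = 0` on every such film, unconditionally

builds on p205010 (kernel theorem, internal audit signed; external expert review pending) — NOT used in this file.  Lane `prim-bschramm`, seat
`prim-bschramm-p2` (gen 33; class C1b; memo `HOME/bschramm/P2-LATTICES.md` §121); helper file (`--supports stmt-CriticalPhenomena-4575 --as helper`).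

The instance node `HexShadow.LocalLinkage` («HexShadowRouteData») for `TriFilm.hexShadow k`, `k ≥ 2`: by the lifted translations and the lifted rotation
(`TriFilm.liftIso`) every block pair reduces to one centred at `0` and clipped in the `w₀`-direction; there the planar oracle («TriClawSound») and the
template («TriFilmRouteT») give the swap pair, except in the sixteen blocked-corner configurations («TriFilmRouteX3»).
* §1 `localLinkage_at_zero` (arbitrary column sets containing the clipped unit hexagon), `localLinkage_at_zero_blk` (block pairs at `0`, both clip directions);
* §2 **`TriFilm.localLinkage`**: `(TriFilm.hexShadow k).LocalLinkage` for `2 ≤ k`;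
* §3 **`TriFilm.theta_criticalProb_eq_zero`**: for every `k ≥ 2` and every vertex `v` of `𝕋 × {0..k}`, `θ_v(p_c(v)) = 0` — Bernoulli bond percolation on the
  triangular film has no infinite cluster at its own critical point (Duminil-Copin–Sidoravicius–Tassion's slab theorem transplanted to hexagonal symmetry;
  an instance of Benjamini–Schramm's Conjecture for a quasi-transitive graph of cubic growth without quarter-turn symmetry).  Independent of p205010.
[cite: DuminilCopinSidoraviciusTassion2016, Thm. 1 and §2] [cite: BenjaminiSchramm1996, Conj. 4 / Question 3]
-/

noncomputable section

namespace Summit.CriticalPhenomena.PercolationContinuityZ3.Theorems.Transplant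

open MeasureTheory Literature.Probability.Percolation Literature.Probability.LatticeModels SimpleGraph
open scoped Classical

namespace TriFilm

open TriClaw

variable {k : ℕ}

/-! ## §1 At the centre -/

/-- `toSite (0,0) = 0`. [folklore] -/
theorem toSite_zero : toSite ((0 : ℤ), (0 : ℤ)) = 0 := by ext j; fin_cases j <;> rfl

/-- `exceptional t … = true` forces `t = 0`. [folklore] -/
theorem eq_zero_of_exceptional {t : ℕ} {a1 a2 a3 : Pt} (h : exceptional t a1 a2 a3 = true) : t = 0 := by
  simp only [exceptional, Bool.and_eq_true, beq_iff_eq] at h; exact h.1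

/-- **Local linkage at the centre, `w₀`-clipped column sets** (`k ≥ 2`): for column sets `RP ⊇ {w₀ ≤ min tR 3} ∩ hexBall 0 3`, `D ⊇ {w₀ ≤ min tD 3} ∩ hexBall 0 3`
and terminals `E₁ ≠ E₂` over the outer ring with `w₀ ≤ tR`, `w'` over the hexagon with `w₀ ≤ tD`, off the centre column and the columns of `E₁, E₂`: a swap
pair of routings. [cite: DuminilCopinSidoraviciusTassion2016, §2.3 (proof of Fact 2)] -/
theorem localLinkage_at_zero (hk : 2 ≤ k) {tR tD : ℕ} (hRD : tR ≤ tD) {RP D : Set (Site 2)}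
    (hRP : ∀ w : Pt, tn w ≤ 3 → w.1 ≤ ((min tR 3 : ℕ) : ℤ) → toSite w ∈ RP) (hD : ∀ w : Pt, tn w ≤ 3 → w.1 ≤ ((min tD 3 : ℕ) : ℤ) → toSite w ∈ D)
    {E₁ E₂ w' : triFilm k} (hne : E₁ ≠ E₂) (h1 : triNorm (E₁ : Site 2 × Site 1).1 = 3) (h1t : (E₁ : Site 2 × Site 1).1 0 ≤ tR)
    (h2 : triNorm (E₂ : Site 2 × Site 1).1 = 3) (h2t : (E₂ : Site 2 × Site 1).1 0 ≤ tR) (h3 : triNorm (w' : Site 2 × Site 1).1 ≤ 3)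
    (h3t : (w' : Site 2 × Site 1).1 0 ≤ tD) (h3z : (w' : Site 2 × Site 1).1 ≠ 0) (h31 : (w' : Site 2 × Site 1).1 ≠ (E₁ : Site 2 × Site 1).1)
    (h32 : (w' : Site 2 × Site 1).1 ≠ (E₂ : Site 2 × Site 1).1) :
    ∃ r₁ r₂ : (hexShadow k).RouteData RP D E₁ E₂ w', r₁.y = r₂.b ∧ r₁.b = r₂.y := by
  obtain ⟨q₁, j₁, hj₁, rfl⟩ := exists_eq_vx E₁
  obtain ⟨q₂, j₂, hj₂, rfl⟩ := exists_eq_vx E₂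
  obtain ⟨q₃, j₃, hj₃, rfl⟩ := exists_eq_vx w'
  simp only [vx_fst] at h1 h1t h2 h2t h3 h3t h3z h31 h32
  -- integer-pair coordinates
  set a1 : Pt := (q₁ 0, q₁ 1) with ha1
  set a2 : Pt := (q₂ 0, q₂ 1) with ha2
  set a3 : Pt := (q₃ 0, q₃ 1) with ha3
  have e1 : toSite a1 = q₁ := toSite_coords q₁
  have e2 : toSite a2 = q₂ := toSite_coords q₂
  have e3 : toSite a3 = q₃ := toSite_coords q₃
  have n1 : tn a1 = 3 := by have := triNorm_toSite a1; rw [e1, h1] at this; exact_mod_cast this.symm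
  have n2 : tn a2 = 3 := by have := triNorm_toSite a2; rw [e2, h2] at this; exact_mod_cast this.symm
  have n3 : tn a3 ≤ 3 := by have := triNorm_toSite a3; rw [e3] at this; exact_mod_cast this ▸ h3
  have b1 : |q₁ 0| ≤ 3 := by have := (abs_le_triNorm q₁).1; rw [h1] at this; exact this
  have b2 : |q₂ 0| ≤ 3 := by have := (abs_le_triNorm q₂).1; rw [h2] at this; exact this
  have b3 : |q₃ 0| ≤ 3 := (abs_le_triNorm q₃).1.trans h3
  have t1 : a1.1 ≤ ((min tR 3 : ℕ) : ℤ) := by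
    change q₁ 0 ≤ _; rw [abs_le] at b1; rcases le_total tR 3 with h | h
    · rw [min_eq_left h]; exact h1t
    · rw [min_eq_right h]; push_cast; omega
  have t2 : a2.1 ≤ ((min tR 3 : ℕ) : ℤ) := by
    change q₂ 0 ≤ _; rw [abs_le] at b2; rcases le_total tR 3 with h | h
    · rw [min_eq_left h]; exact h2t
    · rw [min_eq_right h]; push_cast; omega
  have t3 : a3.1 ≤ ((min tD 3 : ℕ) : ℤ) := by
    change q₃ 0 ≤ _; rw [abs_le] at b3; rcases le_total tD 3 with h | h
    · rw [min_eq_left h]; exact h3t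
    · rw [min_eq_right h]; push_cast; omega
  have z3 : a3 ≠ (0, 0) := fun h => h3z (by rw [← e3, h, toSite_zero])
  have d31 : a3 ≠ a1 := fun h => h31 (by rw [← e3, ← e1, h])
  have d32 : a3 ≠ a2 := fun h => h32 (by rw [← e3, ← e2, h])
  rw [← e1, ← e2, ← e3]
  rw [← e1, ← e2] at hne
  by_cases hx : exceptional (min tR 3) a1 a2 a3 = true
  · have h0 := eq_zero_of_exceptional hx
    rw [h0] at hx hRP
    exact exists_swap_pair_exceptional hk (fun w hw hw1 => hRP w hw (by simpa using hw1)) (fun w hw hw1 => hD w hw (hw1.trans (by positivity))) hx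
      hj₁ hj₂ hj₃ hne
  · rw [Bool.not_eq_true] at hx
    obtain ⟨ρ₁, ρ₂, ρ₃, ℓ₁, ℓ₂, ℓ₃, L1, L2, L3, h12, h31', h32'⟩ :=
      TriFilm.exists_legs (min_le_min_right 3 hRD) (min_le_right _ _) n1 t1 n2 t2 n3 t3 z3 d31 d32 hx hRP hD
    have h0R : (0 : Site 2) ∈ RP := by have := hRP (0, 0) (by decide) (by positivity); rwa [toSite_zero] at this
    have h0D : (0 : Site 2) ∈ D := by have := hD (0, 0) (by decide) (by positivity); rwa [toSite_zero] at this
    have n1' : triNorm (toSite a1) = 3 := by rw [e1]; exact h1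
    have n2' : triNorm (toSite a2) = 3 := by rw [e2]; exact h2
    exact exists_swap_pair_of_legs hk h0R h0D L1 L2 L3 h12 h31' h32' n1' n2' hj₁ hj₂ hj₃ hne

/-- `triRot60` preserves `triNorm` (private copy; the public statement lives in a heavy arm-event file). [folklore] -/
private theorem triNorm_triRot60_eq (v : Site 2) : triNorm (triRot60 v) = triNorm v := by
  simp only [triNorm, triRot60, Matrix.cons_val_zero, Matrix.cons_val_one, abs_neg]
  rw [show -v 1 + (v 0 + v 1) = v 0 by ring, max_left_comm |v 1| |v 0 + v 1| |v 0|, max_comm |v 1| |v 0|, max_left_comm |v 0 + v 1| |v 0| |v 1|,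
    max_comm |v 0 + v 1| |v 1|]

/-- Coordinates of a lifted rotation. [folklore] -/
theorem liftIso_rot_fst (v : triFilm k) : ((liftIso k triRotIso v : triFilm k) : Site 2 × Site 1).1 = triRot60 (v : Site 2 × Site 1).1 := rfl

/-- **Local linkage at the centre for the block pairs `blk 0 tR sR ⊆ blk 0 tD sD`** (either clip direction; the `σ`-clipped case by the lifted rotation).
[cite: DuminilCopinSidoraviciusTassion2016, §2.3 (proof of Fact 2)] -/
theorem localLinkage_at_zero_blk (hk : 2 ≤ k) {tR tD sR sD : ℕ} (hRD : tR ≤ tD) (hsRD : sR ≤ sD) (hone : 3 ≤ tR ∨ 3 ≤ sR) {F₁ F₂ F₃ : triFilm k} (hne : F₁ ≠ F₂)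
    (h1 : (F₁ : Site 2 × Site 1).1 ∈ blk 0 tR sR) (h1s : (F₁ : Site 2 × Site 1).1 ∈ hexSphere 0 3) (h2 : (F₂ : Site 2 × Site 1).1 ∈ blk 0 tR sR)
    (h2s : (F₂ : Site 2 × Site 1).1 ∈ hexSphere 0 3) (h3 : (F₃ : Site 2 × Site 1).1 ∈ blk 0 tD sD) (h3z : (F₃ : Site 2 × Site 1).1 ≠ 0)
    (h31 : (F₃ : Site 2 × Site 1).1 ≠ (F₁ : Site 2 × Site 1).1) (h32 : (F₃ : Site 2 × Site 1).1 ≠ (F₂ : Site 2 × Site 1).1) :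
    ∃ r₁ r₂ : (hexShadow k).RouteData (blk 0 tR sR) (blk 0 tD sD) F₁ F₂ F₃, r₁.y = r₂.b ∧ r₁.b = r₂.y := by
  rw [mem_hexSphere, sub_zero] at h1s h2s
  rw [mem_blk_iff_lin] at h1 h2 h3
  simp only [Pi.zero_apply, sub_zero, zero_add] at h1 h2 h3
  by_cases hs : 3 ≤ sR
  · -- `w₀`-clip only
    refine localLinkage_at_zero hk hRD (fun w hw hw1 => ?_) (fun w hw hw1 => ?_) hne h1s h1.2.1 h2s h2.2.1 ?_ h3.2.1 h3z h31 h32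
    · rw [mem_blk_iff_lin]
      have := triNorm_toSite w
      simp only [Pi.zero_apply, sub_zero, zero_add, toSite_apply_zero, toSite_apply_one]
      have hb : tn w ≤ 3 := hw
      simp only [tn] at hb
      have hm : ((min tR 3 : ℕ) : ℤ) ≤ tR := by exact_mod_cast min_le_left _ _
      omega
    · rw [mem_blk_iff_lin]
      simp only [Pi.zero_apply, sub_zero, zero_add, toSite_apply_zero, toSite_apply_one]
      have hb : tn w ≤ 3 := hw
      simp only [tn] at hb
      have hm : ((min tD 3 : ℕ) : ℤ) ≤ tD := by exact_mod_cast min_le_left _ _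
      omega
    · have hlin : (F₃ : Site 2 × Site 1).1 ∈ hexBall (0 : Site 2) 3 := by
        rw [mem_hexBall_iff_lin]; simp only [Pi.zero_apply, sub_zero]; exact h3.1
      rw [mem_hexBall, sub_zero] at hlin; exact_mod_cast hlin
  · -- `σ`-clip: rotate
    have htR : 3 ≤ tR := by omega
    set β := liftIso k triRotIso with hβ
    obtain ⟨G₁, rfl⟩ : ∃ G, β G = F₁ := ⟨β.symm F₁, β.apply_symm_apply _⟩
    obtain ⟨G₂, rfl⟩ : ∃ G, β G = F₂ := ⟨β.symm F₂, β.apply_symm_apply _⟩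
    obtain ⟨G₃, rfl⟩ : ∃ G, β G = F₃ := ⟨β.symm F₃, β.apply_symm_apply _⟩
    simp only [hβ, liftIso_rot_fst] at h1 h2 h3 h1s h2s h3z h31 h32
    have hGne : G₁ ≠ G₂ := fun h => hne (by rw [h])
    set RP' : Set (Site 2) := {q | triRot60 q ∈ blk 0 tR sR} with hRP'
    set D' : Set (Site 2) := {q | triRot60 q ∈ blk 0 tD sD} with hD'
    have key : ∃ r₁ r₂ : (hexShadow k).RouteData RP' D' G₁ G₂ G₃, r₁.y = r₂.b ∧ r₁.b = r₂.y := by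
      refine localLinkage_at_zero hk hsRD (fun w hw hw1 => ?_) (fun w hw hw1 => ?_) hGne ?_ ?_ ?_ ?_ ?_ ?_ ?_ ?_ ?_
      · change triRot60 (toSite w) ∈ blk 0 tR sR
        rw [mem_blk_iff_lin]
        have hb : tn w ≤ 3 := hw
        simp only [tn] at hb
        have hm : ((min sR 3 : ℕ) : ℤ) ≤ sR := by exact_mod_cast min_le_left _ _
        simp only [triRot60, toSite_apply_zero, toSite_apply_one, Pi.zero_apply, sub_zero, zero_add, Matrix.cons_val_zero, Matrix.cons_val_one]
        omega
      · change triRot60 (toSite w) ∈ blk 0 tD sD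
        rw [mem_blk_iff_lin]
        have hb : tn w ≤ 3 := hw
        simp only [tn] at hb
        have hm : ((min sD 3 : ℕ) : ℤ) ≤ sD := by exact_mod_cast min_le_left _ _
        simp only [triRot60, toSite_apply_zero, toSite_apply_one, Pi.zero_apply, sub_zero, zero_add, Matrix.cons_val_zero, Matrix.cons_val_one]
        omega
      · rwa [triNorm_triRot60_eq] at h1s
      · have := h1.2.2; simp only [triRot60, Matrix.cons_val_zero, Matrix.cons_val_one] at this; linarith
      · rwa [triNorm_triRot60_eq] at h2s
      · have := h2.2.2; simp only [triRot60, Matrix.cons_val_zero, Matrix.cons_val_one] at this; linarith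
      · have := h3.1
        simp only [triRot60, Matrix.cons_val_zero, Matrix.cons_val_one] at this
        simp only [triNorm, max_le_iff, abs_le]
        omega
      · have := h3.2.2; simp only [triRot60, Matrix.cons_val_zero, Matrix.cons_val_one] at this; linarith
      · intro h; apply h3z; rw [h]; ext j; fin_cases j <;> simp [triRot60]
      · intro h; exact h31 (by rw [h])
      · intro h; exact h32 (by rw [h])
    obtain ⟨r₁, r₂, hy, hb⟩ := key
    refine ⟨r₁.map β triRot60 (fun v => rfl) (fun q hq => hq) (fun q hq => hq), r₂.map β triRot60 (fun v => rfl) (fun q hq => hq) (fun q hq => hq), ?_, ?_⟩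
    · rw [HexShadow.RouteData.map_y, HexShadow.RouteData.map_b, hy]
    · rw [HexShadow.RouteData.map_y, HexShadow.RouteData.map_b, hb]

/-! ## §2 Local linkage -/

/-- Coordinates of a lifted translation. [folklore] -/
theorem liftIso_shift_fst (z : Site 2) (v : triFilm k) :
    ((liftIso k (triShiftIso z) v : triFilm k) : Site 2 × Site 1).1 = (v : Site 2 × Site 1).1 + z := rfl

/-- Blocks translate. [folklore] -/
theorem mem_blk_sub_iff {z w : Site 2} {t s : ℕ} : w ∈ blk z t s ↔ w - z ∈ blk 0 t s := by
  rw [mem_blk_iff_lin, mem_blk_iff_lin]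
  simp only [Pi.sub_apply, Pi.zero_apply, sub_zero, zero_add]
  constructor <;> rintro ⟨h1, h2, h3⟩ <;> refine ⟨h1, ?_, ?_⟩ <;> omega

/-- **LOCAL LINKAGE FOR `𝕋 × {0..k}`, `k ≥ 2`.** [cite: DuminilCopinSidoraviciusTassion2016, §2.3 (proof of Fact 2)] -/
theorem localLinkage (hk : 2 ≤ k) : (hexShadow k).LocalLinkage := by
  intro z tR tD sR sD hRD hsRD hone E₁ E₂ w' hne h1 h1s h2 h2s h3 h3z h31 h32
  set α := liftIso k (triShiftIso z) with hα
  obtain ⟨F₁, rfl⟩ : ∃ F, α F = E₁ := ⟨α.symm E₁, α.apply_symm_apply _⟩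
  obtain ⟨F₂, rfl⟩ : ∃ F, α F = E₂ := ⟨α.symm E₂, α.apply_symm_apply _⟩
  obtain ⟨F₃, rfl⟩ : ∃ F, α F = w' := ⟨α.symm w', α.apply_symm_apply _⟩
  change ((α F₁ : triFilm k) : Site 2 × Site 1).1 ∈ _ at h1
  change ((α F₁ : triFilm k) : Site 2 × Site 1).1 ∈ _ at h1s
  change ((α F₂ : triFilm k) : Site 2 × Site 1).1 ∈ _ at h2
  change ((α F₂ : triFilm k) : Site 2 × Site 1).1 ∈ _ at h2s
  change ((α F₃ : triFilm k) : Site 2 × Site 1).1 ∈ _ at h3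
  change ((α F₃ : triFilm k) : Site 2 × Site 1).1 ≠ _ at h3z
  change ((α F₃ : triFilm k) : Site 2 × Site 1).1 ≠ ((α F₁ : triFilm k) : Site 2 × Site 1).1 at h31
  change ((α F₃ : triFilm k) : Site 2 × Site 1).1 ≠ ((α F₂ : triFilm k) : Site 2 × Site 1).1 at h32
  simp only [hα, liftIso_shift_fst] at h1 h1s h2 h2s h3 h3z h31 h32
  rw [mem_blk_sub_iff, add_sub_cancel_right] at h1 h2 h3
  rw [mem_hexSphere, add_sub_cancel_right] at h1s h2s
  have hFne : F₁ ≠ F₂ := fun h => hne (by rw [h])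
  obtain ⟨r₁, r₂, hy, hb⟩ := localLinkage_at_zero_blk hk hRD hsRD hone hFne h1 (by rw [mem_hexSphere, sub_zero]; exact h1s) h2
    (by rw [mem_hexSphere, sub_zero]; exact h2s) h3 (fun h => h3z (by rw [h, zero_add])) (fun h => h31 (by rw [h])) (fun h => h32 (by rw [h]))
  refine ⟨r₁.map α (· + z) (fun v => rfl) (fun q hq => ?_) (fun q hq => ?_), r₂.map α (· + z) (fun v => rfl) (fun q hq => ?_) (fun q hq => ?_), ?_, ?_⟩
  · rwa [mem_blk_sub_iff, add_sub_cancel_right]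
  · rwa [mem_blk_sub_iff, add_sub_cancel_right]
  · rwa [mem_blk_sub_iff, add_sub_cancel_right]
  · rwa [mem_blk_sub_iff, add_sub_cancel_right]
  · rw [HexShadow.RouteData.map_y, HexShadow.RouteData.map_b, hy]
  · rw [HexShadow.RouteData.map_y, HexShadow.RouteData.map_b, hb]

/-! ## §3 The triangular films die at their own critical point -/

/-- **`θ_v(p_c) = 0` ON THE TRIANGULAR FILMS `𝕋 × {0..k}`, `k ≥ 2`, AT EVERY VERTEX — UNCONDITIONALLY.**  Bernoulli bond percolation on the film of `k + 1 ≥ 3`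
triangular layers has no infinite cluster at its own critical point.  Duminil-Copin–Sidoravicius–Tassion's theorem for `ℤ² × {0..k}` transplanted to hexagonal
symmetry: eq. (1), Lemmata 4–7, the gluing Lemma 6 with its local surgery, the renormalisation and the assembly are the tree's generic `HexShadow` chain; the
instance supplies the hexagonal shadow (gen 31), a.s. uniqueness of the infinite cluster («TriFilmScope») and the local linkage of this file.  Independent of
p205010. [cite: DuminilCopinSidoraviciusTassion2016, Thm. 1 and §2] [cite: BenjaminiSchramm1996, Conj. 4 / Question 3] -/
theorem theta_criticalProb_eq_zero {k : ℕ} (hk : 2 ≤ k) (v : triFilm k) : theta (film k) v (criticalProbIOf (film k) v) = 0 :=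
  TriFilm.theta_criticalProb_eq_zero_of_localLinkage k (localLinkage hk) v

end TriFilm

end Summit.CriticalPhenomena.PercolationContinuityZ3.Theorems.Transplant

end
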